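import Mathlib
import Literature.Computability.QuantumComplexity.PauliParseval
import Literature.Computability.Cryptography.QubitRegister

/-!
# Route SymplecticPurity · item SymplecticPurityBound — data ⊗ ancilla factorisation (helper file 3/5)

For `χ = ψ ⊗ |0^m⟩` (`tensorVec ψ (zeroState m)`, data wires first) and a Pauli string `T` on
`n + m` wires, `⟨χ|σ_T|χ⟩ = ⟨ψ|σ_{T|data}|ψ⟩ · ⟨0^m|σ_{T|anc}|0^m⟩`, and the ancilla factor is `1`
if `T` is diagonal (`I`/`Z`) on every ancilla wire and `0` otherwise. Consequently, for a unit
`ε`-flat `ψ` (all non-identity Pauli expectations at most `ε` in modulus),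
`|⟨χ|σ_T|χ⟩|² ≤ [T ∈ I^n ⊗ {I,Z}^m] + ε² [T|anc ∈ {I,Z}^m]`, and summing over any family of strings
bounds its spectral mass by two label counts.
-/

noncomputable section

set_option linter.dupNamespace false -- D-0017: single-problem summit ⇒ `QuantumAdvantage.QuantumAdvantage` by design

open Matrix Finset
open Literature.Computability.QuantumComplexity Literature.Computability.Cryptography

namespace Summit.QuantumAdvantage.QuantumAdvantage.Theorems.SymplecticPurity

/-- The expectation `⟨v|σ_S|v⟩` as a double sum over labels (register form). -/
theorem exp_eq_sum_prod {k : ℕ} (v : (Fin k → Bool) → ℂ) (S : Fin k → Pauli) :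
    star v ⬝ᵥ (pauliString S *ᵥ v) =
      ∑ p : (Fin k → Bool) × (Fin k → Bool), star (v p.1) * (pauliString S p.1 p.2 * v p.2) := by
  rw [Fintype.sum_prod_type]
  simp only [dotProduct, Matrix.mulVec, Pi.star_apply, Finset.mul_sum]

/-- **Factorisation of Pauli expectations on a product vector**:
`⟨ψ ⊗ ζ| σ_T |ψ ⊗ ζ⟩ = ⟨ψ|σ_{T|data}|ψ⟩ · ⟨ζ|σ_{T|anc}|ζ⟩` (data wires `castAdd`, ancilla wires
`natAdd`). -/
theorem exp_tensorVec (n m : ℕ) (ψ : (Fin n → Bool) → ℂ) (ζ : (Fin m → Bool) → ℂ)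
    (T : Fin (n + m) → Pauli) :
    star (tensorVec ψ ζ) ⬝ᵥ (pauliString T *ᵥ tensorVec ψ ζ) =
      (star ψ ⬝ᵥ (pauliString (fun i => T (Fin.castAdd m i)) *ᵥ ψ)) *
        (star ζ ⬝ᵥ (pauliString (fun j => T (Fin.natAdd n j)) *ᵥ ζ)) := by
  rw [exp_eq_sum_prod, exp_eq_sum_prod, exp_eq_sum_prod, Finset.sum_mul_sum]
  have happ : ∀ (a : Fin n → Bool) (b : Fin m → Bool),
      tensorVec ψ ζ (Fin.append a b) = ψ a * ζ b := by
    intro a b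
    simp only [tensorVec, Fin.append_left, Fin.append_right]
  have hσ : ∀ (a a' : Fin n → Bool) (b b' : Fin m → Bool),
      pauliString T (Fin.append a b) (Fin.append a' b') =
        pauliString (fun i => T (Fin.castAdd m i)) a a' *
          pauliString (fun j => T (Fin.natAdd n j)) b b' := by
    intro a a' b b'
    simp only [pauliString_eq, tensorAll_apply]
    rw [Fin.prod_univ_add]
    simp only [Fin.append_left, Fin.append_right]
  rw [← Fintype.sum_equiv ((Fin.appendEquiv n m).prodCongr (Fin.appendEquiv n m))
    (fun i => star (tensorVec ψ ζ (Fin.append i.1.1 i.1.2)) *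
      (pauliString T (Fin.append i.1.1 i.1.2) (Fin.append i.2.1 i.2.2) *
        tensorVec ψ ζ (Fin.append i.2.1 i.2.2)))
    _ (fun _ => rfl)]
  simp only [happ, hσ]
  simp only [Fintype.sum_prod_type]
  refine Finset.sum_congr rfl fun a _ => ?_
  rw [Finset.sum_comm]
  refine Finset.sum_congr rfl fun a' _ => Finset.sum_congr rfl fun b _ =>
    Finset.sum_congr rfl fun b' _ => ?_
  simp only [star_mul']
  ring

/-- Diagonal entry `⟨0|σ_q|0⟩` of a one-qubit Pauli: `1` for `I, Z` and `0` for `X, Y`. -/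
theorem pauli_mat_false_false (q : Pauli) :
    Pauli.mat q false false = if q = Pauli.I ∨ q = Pauli.Z then 1 else 0 := by
  cases q <;> simp

/-- **Ancilla factor**: `⟨0^m|σ_R|0^m⟩ = 1` if every letter of `R` is `I` or `Z`, else `0`. -/
theorem exp_zeroState (m : ℕ) (R : Fin m → Pauli) :
    star (zeroState m) ⬝ᵥ (pauliString R *ᵥ zeroState m) =
      if ∀ j, R j = Pauli.I ∨ R j = Pauli.Z then 1 else 0 := by
  have h0 : star (zeroState m) ⬝ᵥ (pauliString R *ᵥ zeroState m) =
      pauliString R (fun _ => false) (fun _ => false) := by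
    simp only [dotProduct, Matrix.mulVec, Pi.star_apply, zeroState, basisState_apply,
      apply_ite star, star_one, star_zero, ite_mul, one_mul, zero_mul, mul_ite, mul_one,
      mul_zero, Finset.sum_ite_eq', Finset.mem_univ, if_true]
  rw [h0]
  simp only [pauliString_eq, tensorAll_apply, pauli_mat_false_false]
  rw [Fintype.prod_ite_zero, Finset.prod_const_one]
  by_cases h : ∀ j, R j = Pauli.I ∨ R j = Pauli.Z
  · rw [if_pos h, if_pos h]
  · rw [if_neg h, if_neg h]

/-- `⟨v|v⟩ = normSq v` (as a complex number). -/
theorem star_dotProduct_self {k : ℕ} (v : (Fin k → Bool) → ℂ) :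
    star v ⬝ᵥ v = ((normSq v : ℝ) : ℂ) := by
  simp only [dotProduct, Pi.star_apply, normSq]
  push_cast
  exact Finset.sum_congr rfl fun x _ => by rw [Complex.star_def, Complex.conj_mul']

/-- `‖ψ ⊗ ζ‖² = ‖ψ‖² ‖ζ‖²`. -/
theorem normSq_tensorVec {n m : ℕ} (ψ : (Fin n → Bool) → ℂ) (ζ : (Fin m → Bool) → ℂ) :
    normSq (tensorVec ψ ζ) = normSq ψ * normSq ζ := by
  simp only [normSq]
  rw [← Fintype.sum_equiv (Fin.appendEquiv n m)
    (fun ab => ‖tensorVec ψ ζ (Fin.append ab.1 ab.2)‖ ^ 2) _ (fun _ => rfl),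
    Fintype.sum_prod_type, Finset.sum_mul_sum]
  refine Finset.sum_congr rfl fun a _ => Finset.sum_congr rfl fun b _ => ?_
  simp only [tensorVec, Fin.append_left, Fin.append_right, norm_mul, mul_pow]

/-- `ψ ⊗ |0^m⟩` is a unit vector when `ψ` is. -/
theorem normSq_tensorVec_zeroState {n : ℕ} (m : ℕ) {ψ : (Fin n → Bool) → ℂ} (hψ : normSq ψ = 1) :
    normSq (tensorVec ψ (zeroState m)) = 1 := by
  rw [normSq_tensorVec, hψ, zeroState, normSq_basisState, one_mul]

/-- **Single-string bound**: for a unit `ε`-flat `ψ`, the squared expectation of `σ_T` in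
`ψ ⊗ |0^m⟩` is at most `[T ∈ I^n ⊗ {I,Z}^m] + ε² [T|anc ∈ {I,Z}^m]`. -/
theorem norm_exp_tensorVec_zeroState_sq_le {n : ℕ} (m : ℕ) (ε : ℝ) {ψ : (Fin n → Bool) → ℂ}
    (hψ : normSq ψ = 1)
    (hflat : ∀ S : Fin n → Pauli, S ≠ (fun _ => Pauli.I) →
      ‖star ψ ⬝ᵥ (pauliString S *ᵥ ψ)‖ ≤ ε)
    (T : Fin (n + m) → Pauli) :
    ‖star (tensorVec ψ (zeroState m)) ⬝ᵥ (pauliString T *ᵥ tensorVec ψ (zeroState m))‖ ^ 2 ≤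
      (if (∀ i : Fin n, T (Fin.castAdd m i) = Pauli.I) ∧
            (∀ j : Fin m, T (Fin.natAdd n j) = Pauli.I ∨ T (Fin.natAdd n j) = Pauli.Z)
        then (1 : ℝ) else 0) +
      (if ∀ j : Fin m, T (Fin.natAdd n j) = Pauli.I ∨ T (Fin.natAdd n j) = Pauli.Z
        then ε ^ 2 else 0) := by
  rw [exp_tensorVec, exp_zeroState]
  by_cases hanc : ∀ j : Fin m, T (Fin.natAdd n j) = Pauli.I ∨ T (Fin.natAdd n j) = Pauli.Z
  · rw [if_pos hanc, if_pos hanc, mul_one]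
    by_cases hdat : ∀ i : Fin n, T (Fin.castAdd m i) = Pauli.I
    · rw [if_pos ⟨hdat, hanc⟩]
      have hI : (fun i => T (Fin.castAdd m i)) = fun _ => Pauli.I := funext hdat
      rw [hI, pauliString_const_I, Matrix.one_mulVec, star_dotProduct_self, hψ]
      simp only [Complex.ofReal_one, norm_one, one_pow]
      nlinarith [sq_nonneg ε]
    · rw [if_neg (fun h => hdat h.1), zero_add]
      have hne : (fun i => T (Fin.castAdd m i)) ≠ fun _ => Pauli.I :=
        fun h => hdat (fun i => congrFun h i)
      have h := hflat _ hne
      have h0 : 0 ≤ ‖star ψ ⬝ᵥ (pauliString (fun i => T (Fin.castAdd m i)) *ᵥ ψ)‖ :=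
        norm_nonneg _
      nlinarith
  · rw [if_neg hanc, if_neg hanc, if_neg (fun h => hanc h.2), mul_zero, norm_zero, add_zero]
    norm_num

/-- **Spectral mass of a family of strings**: summing the single-string bound over any finite
family `M`, `Σ_{T ∈ M} |⟨χ|σ_T|χ⟩|² ≤ #{T ∈ M : T ∈ I^n ⊗ {I,Z}^m} + ε² · #{T ∈ M : T|anc ∈ {I,Z}^m}`. -/
theorem sum_norm_exp_sq_le_card_add {n : ℕ} (m : ℕ) (ε : ℝ) {ψ : (Fin n → Bool) → ℂ}
    (hψ : normSq ψ = 1)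
    (hflat : ∀ S : Fin n → Pauli, S ≠ (fun _ => Pauli.I) →
      ‖star ψ ⬝ᵥ (pauliString S *ᵥ ψ)‖ ≤ ε)
    (M : Finset (Fin (n + m) → Pauli)) :
    ∑ T ∈ M, ‖star (tensorVec ψ (zeroState m)) ⬝ᵥ
        (pauliString T *ᵥ tensorVec ψ (zeroState m))‖ ^ 2 ≤
      ((M.filter fun T => (∀ i : Fin n, T (Fin.castAdd m i) = Pauli.I) ∧
          (∀ j : Fin m, T (Fin.natAdd n j) = Pauli.I ∨ T (Fin.natAdd n j) = Pauli.Z)).card : ℝ) +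
      ε ^ 2 * ((M.filter fun T =>
          ∀ j : Fin m, T (Fin.natAdd n j) = Pauli.I ∨ T (Fin.natAdd n j) = Pauli.Z).card : ℝ) := by
  refine (Finset.sum_le_sum fun T _ => norm_exp_tensorVec_zeroState_sq_le m ε hψ hflat T).trans ?_
  rw [Finset.sum_add_distrib, Finset.sum_boole]
  simp only [← mul_boole _ (ε ^ 2)]
  rw [← Finset.mul_sum, Finset.sum_boole]

end Summit.QuantumAdvantage.QuantumAdvantage.Theorems.SymplecticPurity

end
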